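import Literature.Computability.Complexity.RandomizingPolynomialsBlock
import Mathlib.Data.Finset.Sort
import HarnessLib

/-!
# Orbit kit for `orbit-pair-rsr`, I: the algebraic normal form of sparse cubic polynomials over `F₂`

Helper file of the stub `stub_orbitKit` (crux `SzkEntropy.PeaWorstToAvg`, line `orbit-pair-rsr`).
Sparse polynomials over `F₂` with `ℕ`-indexed variables are lists of monomials (lists of indices),
valued by `RandPoly.evalP`.  We fix a CANONICAL multilinear normal form in degree `≤ 3`:

* `allMonos s` — the fixed enumeration of the multilinear monomials of degree `≤ 3` in the variables
  `0, …, s-1` (strictly increasing index lists), `sameSet`, and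
  `canonP s q = (allMonos s).filter (odd multiplicity of the monomial, as a set, in q)`;
* `evalP_canonP` — `canonP s q` has the same values as `q` (multilinearisation `xᵢ² = xᵢ` and reduction
  mod `2`), for `q` with indices `< s` and at most `3` distinct indices per monomial;
* `canonP_eq_of_evalP_eq` — **uniqueness of the algebraic normal form** (Zhegalkin / Möbius
  inversion on the cube): two canonical forms with the same values are equal, so `canonP s q` depends
  only on the function `F₂ˢ → F₂` defined by `q`.

References: I. I. Zhegalkin (1927) / R. O'Donnell, *Analysis of Boolean Functions*, CUP 2014, §6.2
(uniqueness of the `𝔽₂`-polynomial representation); Dvir–Gutfreund–Rothblum–Vadhan, ICS 2011, §2.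
-/

namespace Summit.PneNP.PneNP.Cruxes.PeaWorstToAvg.OrbitPairRsr

set_option linter.dupNamespace false -- Summit.PneNP.PneNP: summit = sub-problem (D-0017)

open Literature.Computability.Complexity RandPoly

namespace OKit

/-! ### Values of monomials over `F₂` -/

/-- Every element of `F₂` is `0` or `1`. [folklore] -/
theorem z2_cases (x : ZMod 2) : x = 0 ∨ x = 1 := by
  revert x; decide

/-- A monomial over `F₂` is the indicator that all its variables are `1`. [folklore] -/
theorem prod_map_eq (v : ℕ → ZMod 2) (μ : List ℕ) :
    (μ.map v).prod = if ∀ i ∈ μ, v i = 1 then 1 else 0 := by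
  induction μ with
  | nil => simp
  | cons a μ ih =>
    rw [List.map_cons, List.prod_cons, ih]
    rcases z2_cases (v a) with ha | ha <;> simp [ha]

/-- The value of a monomial depends only on the SET of its variables (`xᵢ² = xᵢ`). [folklore] -/
theorem prod_map_congr_set (v : ℕ → ZMod 2) {μ ν : List ℕ} (h : ∀ i, i ∈ μ ↔ i ∈ ν) :
    (μ.map v).prod = (ν.map v).prod := by
  rw [prod_map_eq, prod_map_eq]
  have : (∀ i ∈ μ, v i = 1) ↔ ∀ i ∈ ν, v i = 1 :=
    ⟨fun H i hi => H i ((h i).2 hi), fun H i hi => H i ((h i).1 hi)⟩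
  simp only [this]

/-- Two monomials have the same set of variables (Boolean test). [folklore] -/
def sameSet (ν μ : List ℕ) : Bool :=
  ν.all (fun i => decide (i ∈ μ)) && μ.all (fun i => decide (i ∈ ν))

/-- `sameSet` decides equality of the variable sets. [folklore] -/
theorem sameSet_iff {ν μ : List ℕ} : sameSet ν μ = true ↔ ∀ i, i ∈ ν ↔ i ∈ μ := by
  simp only [sameSet, Bool.and_eq_true, List.all_eq_true, decide_eq_true_eq]
  exact ⟨fun ⟨h₁, h₂⟩ i => ⟨h₁ i, h₂ i⟩, fun h => ⟨fun i => (h i).1, fun i => (h i).2⟩⟩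

/-- `sameSet` in terms of `toFinset`. [folklore] -/
theorem sameSet_iff_toFinset {ν μ : List ℕ} : sameSet ν μ = true ↔ ν.toFinset = μ.toFinset := by
  rw [sameSet_iff, Finset.ext_iff]
  simp only [List.mem_toFinset]

/-! ### The enumeration of multilinear monomials of degree `≤ 3` -/

/-- The multilinear monomials of degree `≤ 3` in the variables `0, …, s - 1`, each listed once as a
strictly increasing index list: `[]`, `[i]`, `[i, j]` (`i < j`), `[i, j, k]` (`i < j < k`). [folklore] -/
def allMonos (s : ℕ) : List (List ℕ) :=
  [[]] ++ (List.range s).map (fun i => [i]) ++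
    (((List.range s) ×ˢ (List.range s)).filter fun p => decide (p.1 < p.2)).map
      (fun p => [p.1, p.2]) ++
    (((List.range s) ×ˢ ((List.range s) ×ˢ (List.range s))).filter fun p =>
        decide (p.1 < p.2.1) && decide (p.2.1 < p.2.2)).map (fun p => [p.1, p.2.1, p.2.2])

/-- Characterisation of the enumerated monomials: strictly increasing, length `≤ 3`, indices `< s`.
[folklore] -/
theorem mem_allMonos_iff {s : ℕ} {μ : List ℕ} :
    μ ∈ allMonos s ↔ μ.Pairwise (· < ·) ∧ μ.length ≤ 3 ∧ ∀ i ∈ μ, i < s := by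
  constructor
  · intro h
    simp only [allMonos, List.append_assoc, List.mem_append, List.mem_singleton, List.mem_map,
      List.mem_filter, List.mem_product, List.mem_range, decide_eq_true_eq,
      Bool.and_eq_true, Prod.exists] at h
    rcases h with rfl | ⟨i, hi, rfl⟩ | ⟨i, j, ⟨⟨hi, hj⟩, hij⟩, rfl⟩ |
      ⟨i, j, k, ⟨⟨hi, hj, hk⟩, hij, hjk⟩, rfl⟩
    · simp
    · simp [hi]
    · refine ⟨?_, by simp, ?_⟩
      · simp [hij]
      · simp [hi, hj]
    · refine ⟨?_, by simp, ?_⟩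
      · simp [hij, hjk, hij.trans hjk]
      · simp [hi, hj, hk]
  · rintro ⟨hsort, hlen, hlt⟩
    simp only [allMonos, List.append_assoc, List.mem_append, List.mem_singleton, List.mem_map,
      List.mem_filter, List.mem_product, List.mem_range, decide_eq_true_eq,
      Bool.and_eq_true, Prod.exists]
    match μ, hsort, hlen, hlt with
    | [], _, _, _ => exact Or.inl rfl
    | [i], _, _, hlt => exact Or.inr (Or.inl ⟨i, hlt i (by simp), rfl⟩)
    | [i, j], hsort, _, hlt =>
      refine Or.inr (Or.inr (Or.inl ⟨i, j, ⟨⟨hlt i (by simp), hlt j (by simp)⟩, ?_⟩, rfl⟩))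
      exact List.rel_of_pairwise_cons hsort (by simp)
    | [i, j, k], hsort, _, hlt =>
      refine Or.inr (Or.inr (Or.inr ⟨i, j, k,
        ⟨⟨hlt i (by simp), hlt j (by simp), hlt k (by simp)⟩, ?_, ?_⟩, rfl⟩))
      · exact List.rel_of_pairwise_cons hsort (by simp)
      · exact List.rel_of_pairwise_cons (List.Pairwise.of_cons hsort) (by simp)
    | _ :: _ :: _ :: _ :: _, _, hlen, _ => simp at hlen; omega

/-- Enumerated monomials are strictly increasing. [folklore] -/
theorem pairwise_of_mem_allMonos {s : ℕ} {μ : List ℕ} (h : μ ∈ allMonos s) : μ.Pairwise (· < ·) :=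
  (mem_allMonos_iff.1 h).1

/-- Enumerated monomials have length `≤ 3`. [folklore] -/
theorem length_of_mem_allMonos {s : ℕ} {μ : List ℕ} (h : μ ∈ allMonos s) : μ.length ≤ 3 :=
  (mem_allMonos_iff.1 h).2.1

/-- Enumerated monomials only use the variables `< s`. [folklore] -/
theorem lt_of_mem_allMonos {s : ℕ} {μ : List ℕ} (h : μ ∈ allMonos s) : ∀ i ∈ μ, i < s :=
  (mem_allMonos_iff.1 h).2.2

/-- The enumeration lists every monomial once. [folklore] -/
theorem nodup_allMonos (s : ℕ) : (allMonos s).Nodup := by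
  have hR : (List.range s).Nodup := List.nodup_range
  have h1 : ((List.range s).map (fun i => [i])).Nodup := hR.map fun a b h => by simpa using h
  have h2 : ((((List.range s) ×ˢ (List.range s)).filter fun p => decide (p.1 < p.2)).map
      (fun p => [p.1, p.2])).Nodup :=
    ((hR.product hR).filter _).map fun a b h => by
      obtain ⟨a1, a2⟩ := a; obtain ⟨b1, b2⟩ := b
      simp only [List.cons.injEq, and_true] at h
      rw [h.1, h.2]
  have h3 : ((((List.range s) ×ˢ ((List.range s) ×ˢ (List.range s))).filter fun p =>
      decide (p.1 < p.2.1) && decide (p.2.1 < p.2.2)).map (fun p => [p.1, p.2.1, p.2.2])).Nodup :=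
    ((hR.product (hR.product hR)).filter _).map fun a b h => by
      obtain ⟨a1, a2, a3⟩ := a; obtain ⟨b1, b2, b3⟩ := b
      simp only [List.cons.injEq, and_true] at h
      rw [h.1, h.2.1, h.2.2]
  -- lengths of the items of the four parts are 0, 1, 2, 3 respectively
  have hl1 : ∀ μ ∈ (List.range s).map (fun i => [i]), μ.length = 1 := fun μ h => by
    obtain ⟨i, -, rfl⟩ := List.mem_map.1 h; rfl
  have hl2 : ∀ μ ∈ (((List.range s) ×ˢ (List.range s)).filter fun p => decide (p.1 < p.2)).map
      (fun p => [p.1, p.2]), μ.length = 2 := fun μ h => by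
    obtain ⟨p, -, rfl⟩ := List.mem_map.1 h; rfl
  have hl3 : ∀ μ ∈ (((List.range s) ×ˢ ((List.range s) ×ˢ (List.range s))).filter fun p =>
      decide (p.1 < p.2.1) && decide (p.2.1 < p.2.2)).map (fun p => [p.1, p.2.1, p.2.2]),
      μ.length = 3 := fun μ h => by
    obtain ⟨p, -, rfl⟩ := List.mem_map.1 h; rfl
  simp only [allMonos, List.append_assoc]
  refine List.nodup_append.2 ⟨List.nodup_singleton _, List.nodup_append.2 ⟨h1, List.nodup_append.2
    ⟨h2, h3, fun μ hb μ' hc heq => ?_⟩, fun μ ha μ' hbc heq => ?_⟩, fun μ h0 μ' h heq => ?_⟩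
  · subst heq; have := hl2 μ hb; have := hl3 μ hc; omega
  · subst heq
    have := hl1 μ ha
    rcases List.mem_append.1 hbc with h | h
    · have := hl2 μ h; omega
    · have := hl3 μ h; omega
  · subst heq
    rw [List.mem_singleton] at h0
    subst h0
    rcases List.mem_append.1 h with h | h
    · have := hl1 _ h; simp at this
    · rcases List.mem_append.1 h with h | h
      · have := hl2 _ h; simp at this
      · have := hl3 _ h; simp at this

/-- Two enumerated monomials with the same variable set are equal. [folklore] -/
theorem eq_of_mem_allMonos_of_sameSet {s : ℕ} {μ μ' : List ℕ} (h : μ ∈ allMonos s)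
    (h' : μ' ∈ allMonos s) (hs : sameSet μ μ' = true) : μ = μ' :=
  (pairwise_of_mem_allMonos h).eq_of_mem_iff (pairwise_of_mem_allMonos h') (sameSet_iff.1 hs)

/-- **Completeness of the enumeration**: every monomial with indices `< s` and at most `3` distinct
variables has the same variable set as some enumerated monomial (the sorted list of its variable
set; it is unique by `eq_of_mem_allMonos_of_sameSet`). [folklore] -/
theorem exists_mem_allMonos_sameSet {s : ℕ} {ν : List ℕ} (hlt : ∀ i ∈ ν, i < s)
    (hcard : ν.toFinset.card ≤ 3) : ∃ μ ∈ allMonos s, sameSet ν μ = true := by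
  refine ⟨ν.toFinset.sort, mem_allMonos_iff.2 ⟨?_, ?_, ?_⟩, ?_⟩
  · exact List.sortedLT_iff_pairwise.1 (Finset.sortedLT_sort _)
  · rw [Finset.length_sort]; exact hcard
  · intro i hi
    rw [Finset.mem_sort, List.mem_toFinset] at hi
    exact hlt i hi
  · exact sameSet_iff.2 fun i => by rw [Finset.mem_sort, List.mem_toFinset]

/-! ### Sums over duplicate-free lists -/

/-- A sum over a duplicate-free list of a function supported at one of its items. [folklore] -/
theorem sum_map_ite_eq {α M : Type*} [DecidableEq α] [AddCommMonoid M] {l : List α} (hl : l.Nodup)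
    {a : α} (ha : a ∈ l) (x : M) : (l.map fun b => if b = a then x else 0).sum = x := by
  rw [← List.sum_toFinset _ hl, Finset.sum_ite_eq', if_pos (List.mem_toFinset.2 ha)]

/-- Value of a filtered polynomial. [folklore] -/
theorem evalP_filter (v : ℕ → ZMod 2) (c : List ℕ → Bool) (l : List (List ℕ)) :
    evalP v (l.filter c) = (l.map fun μ => if c μ then (μ.map v).prod else 0).sum := by
  induction l with
  | nil => simp [evalP]
  | cons μ l ih =>
    rw [List.filter_cons, List.map_cons, List.sum_cons]
    split
    · rw [evalP_cons, ih]
    · rw [ih, zero_add]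

/-! ### The canonical form -/

/-- **The canonical (algebraic normal) form in degree `≤ 3`**: the enumerated monomials that occur
in `q` — as variable SETS, i.e. after multilinearisation `xᵢ² = xᵢ` — an odd number of times
(reduction mod `2`), in the fixed order of `allMonos s`. [folklore] -/
def canonP (s : ℕ) (q : List (List ℕ)) : List (List ℕ) :=
  (allMonos s).filter fun μ => decide (q.countP (fun ν => sameSet ν μ) % 2 = 1)

/-- The canonical form of a sparse map, coordinatewise. [folklore] -/
def canonM (s : ℕ) (Q : List (List (List ℕ))) : List (List (List ℕ)) := Q.map (canonP s)

/-- Monomials of a canonical form are enumerated monomials. [folklore] -/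
theorem mem_allMonos_of_mem_canonP {s : ℕ} {q : List (List ℕ)} {μ : List ℕ} (h : μ ∈ canonP s q) :
    μ ∈ allMonos s :=
  List.mem_of_mem_filter h

/-- The canonical form of a map has the same number of coordinates. [folklore] -/
@[simp] theorem length_canonM (s : ℕ) (Q : List (List (List ℕ))) : (canonM s Q).length = Q.length :=
  List.length_map _

/-- Monomials of a canonical map: indices `< s`, length `≤ 3`. [folklore] -/
theorem canonM_wf {s : ℕ} {Q : List (List (List ℕ))} {p : List (List ℕ)} (hp : p ∈ canonM s Q)
    {μ : List ℕ} (hμ : μ ∈ p) : (∀ i ∈ μ, i < s) ∧ μ.length ≤ 3 := by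
  obtain ⟨q, -, rfl⟩ := List.mem_map.1 hp
  have h := mem_allMonos_of_mem_canonP hμ
  exact ⟨lt_of_mem_allMonos h, length_of_mem_allMonos h⟩

/-- The multiplicity of a variable set in `q`, mod `2`. [folklore] -/
def coef (q : List (List ℕ)) (μ : List ℕ) : ZMod 2 := (q.countP (fun ν => sameSet ν μ) : ℕ)

/-- The parity test of `canonP` is the coefficient. [folklore] -/
theorem ite_coef (q : List (List ℕ)) (μ : List ℕ) (x : ZMod 2) :
    (if decide (q.countP (fun ν => sameSet ν μ) % 2 = 1) then x else 0) = coef q μ * x := by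
  unfold coef
  by_cases h : q.countP (fun ν => sameSet ν μ) % 2 = 1
  · rw [if_pos (decide_eq_true h), (ZMod.natCast_eq_one_iff_odd.2 (Nat.odd_iff.2 h)), one_mul]
  · rw [if_neg (by simpa using h), (ZMod.natCast_eq_zero_iff_even.2 (Nat.even_iff.2 (by omega))),
      zero_mul]

/-- **Value of the canonical form as a coefficient sum** over the enumerated monomials. [folklore] -/
theorem evalP_canonP_eq_sum (v : ℕ → ZMod 2) (s : ℕ) (q : List (List ℕ)) :
    evalP v (canonP s q) = ((allMonos s).map fun μ => coef q μ * (μ.map v).prod).sum := by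
  rw [canonP, evalP_filter]
  congr 1
  exact List.map_congr_left fun μ _ => ite_coef q μ _

/-- The coefficient of the empty polynomial. [folklore] -/
@[simp] theorem coef_nil (μ : List ℕ) : coef [] μ = 0 := by simp [coef]

/-- The coefficient is additive in the monomials. [folklore] -/
theorem coef_cons (ν : List ℕ) (q : List (List ℕ)) (μ : List ℕ) :
    coef (ν :: q) μ = (if sameSet ν μ then 1 else 0) + coef q μ := by
  rw [coef, List.countP_cons, Nat.cast_add, add_comm, coef]
  congr 1
  split <;> simp

/-- **One monomial in normal form**: summing the indicator of "same variable set as `ν`" against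
the enumerated monomials returns the value of `ν` (the unique enumerated monomial with the variable
set of `ν` has the same value, `xᵢ² = xᵢ`). [folklore] -/
theorem sum_sameSet_eq (v : ℕ → ZMod 2) {s : ℕ} {ν : List ℕ} (hlt : ∀ i ∈ ν, i < s)
    (hcard : ν.toFinset.card ≤ 3) :
    ((allMonos s).map fun μ => (if sameSet ν μ then (1 : ZMod 2) else 0) * (μ.map v).prod).sum =
      (ν.map v).prod := by
  obtain ⟨μ₀, hμ₀, hνμ₀⟩ := exists_mem_allMonos_sameSet hlt hcard
  have hiff : ∀ μ ∈ allMonos s, sameSet ν μ = true ↔ μ = μ₀ := by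
    intro μ hμ
    constructor
    · intro h
      refine eq_of_mem_allMonos_of_sameSet hμ hμ₀ (sameSet_iff.2 fun i => ?_)
      rw [← sameSet_iff.1 h i, sameSet_iff.1 hνμ₀ i]
    · rintro rfl; exact hνμ₀
  have hcongr : ((allMonos s).map fun μ => (if sameSet ν μ then (1 : ZMod 2) else 0) * (μ.map v).prod) =
      (allMonos s).map fun μ => if μ = μ₀ then (ν.map v).prod else 0 := by
    refine List.map_congr_left fun μ hμ => ?_
    by_cases h : sameSet ν μ = true
    · rw [if_pos h, if_pos ((hiff μ hμ).1 h), one_mul, prod_map_congr_set v (sameSet_iff.1 h)]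
    · rw [if_neg h, zero_mul, if_neg (fun h' => h ((hiff μ hμ).2 h'))]
  rw [hcongr, sum_map_ite_eq (nodup_allMonos s) hμ₀]

/-- **The canonical form has the same values** (multilinearisation and reduction mod `2` do not change
the function on `F₂`-points), for polynomials with indices `< s` and at most `3` distinct variables
per monomial. [folklore] -/
theorem evalP_canonP (v : ℕ → ZMod 2) {s : ℕ} {q : List (List ℕ)}
    (hq : ∀ ν ∈ q, (∀ i ∈ ν, i < s) ∧ ν.toFinset.card ≤ 3) : evalP v (canonP s q) = evalP v q := by
  rw [evalP_canonP_eq_sum]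
  induction q with
  | nil => simp
  | cons ν q ih =>
    have hν := hq ν (by simp)
    have ih' := ih fun ν' hν' => hq ν' (List.mem_cons_of_mem _ hν')
    simp only [coef_cons, add_mul]
    rw [List.sum_map_add, ih', sum_sameSet_eq v hν.1 hν.2, evalP_cons]

/-! ### Uniqueness of the normal form -/

/-- **A duplicate-free list of set-distinct multilinear monomials with identically vanishing value is
empty** (evaluate at the indicator of a monomial of minimal degree: only that monomial survives).
This is the uniqueness of the algebraic normal form over `F₂`. [folklore] -/
theorem eq_nil_of_evalP_eq_zero {L : List (List ℕ)} (hN : L.Nodup) (hmono : ∀ μ ∈ L, μ.Nodup)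
    (hset : ∀ μ ∈ L, ∀ μ' ∈ L, sameSet μ μ' = true → μ = μ')
    (h0 : ∀ v : ℕ → ZMod 2, evalP v L = 0) : L = [] := by
  by_contra hne
  obtain ⟨μ₁, hμ₁⟩ := List.exists_mem_of_ne_nil L hne
  obtain ⟨μ₀, hμ₀, hmin⟩ := L.toFinset.exists_min_image List.length ⟨μ₁, List.mem_toFinset.2 hμ₁⟩
  rw [List.mem_toFinset] at hμ₀
  let v : ℕ → ZMod 2 := fun i => if i ∈ μ₀ then 1 else 0
  -- each monomial of `L` evaluates at `v` to the indicator of being `μ₀`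
  have hterm : ∀ μ ∈ L, (μ.map v).prod = if μ = μ₀ then 1 else 0 := by
    intro μ hμ
    rw [prod_map_eq]
    have hv : (∀ i ∈ μ, v i = 1) ↔ ∀ i ∈ μ, i ∈ μ₀ := by
      refine forall₂_congr fun i _ => ?_
      simp only [v]
      split_ifs with h
      · simp [h]
      · simp [h]
    have hiff : (∀ i ∈ μ, i ∈ μ₀) ↔ μ = μ₀ := by
      refine ⟨fun hsub => hset μ hμ μ₀ hμ₀ (sameSet_iff_toFinset.2 ?_), fun h => h ▸ fun i hi => hi⟩
      refine Finset.eq_of_subset_of_card_le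
        (fun i hi => List.mem_toFinset.2 (hsub i (List.mem_toFinset.1 hi))) ?_
      rw [List.toFinset_card_of_nodup (hmono μ hμ), List.toFinset_card_of_nodup (hmono μ₀ hμ₀)]
      exact hmin μ (List.mem_toFinset.2 hμ)
    simp only [hv, hiff]
  have hsum : evalP v L = 1 := by
    unfold evalP
    rw [List.map_congr_left hterm, sum_map_ite_eq hN hμ₀]
  exact one_ne_zero (hsum.symm.trans (h0 v))

/-- In characteristic `2`, the indicator of an exclusive or is the sum of the indicators. [folklore] -/
theorem ite_xor_eq_add (a b : Bool) (x : ZMod 2) :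
    (if (a ^^ b) then x else 0) = (if a then x else 0) + (if b then x else 0) := by
  have hx : x + x = 0 := CharTwo.add_self_eq_zero x
  cases a <;> cases b <;> simp [hx]

/-- **Uniqueness of the canonical form**: canonical forms with the same values are equal.  Hence
`canonP s q` depends only on the function `F₂ˢ → F₂` defined by `q`. [folklore] -/
theorem canonP_eq_of_evalP_eq {s : ℕ} {q₁ q₂ : List (List ℕ)}
    (h : ∀ v : ℕ → ZMod 2, evalP v (canonP s q₁) = evalP v (canonP s q₂)) :
    canonP s q₁ = canonP s q₂ := by
  set c₁ : List ℕ → Bool := fun μ => decide (q₁.countP (fun ν => sameSet ν μ) % 2 = 1) with hc₁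
  set c₂ : List ℕ → Bool := fun μ => decide (q₂.countP (fun ν => sameSet ν μ) % 2 = 1) with hc₂
  set L := (allMonos s).filter fun μ => (c₁ μ ^^ c₂ μ) with hL
  have hLnil : L = [] := by
    refine eq_nil_of_evalP_eq_zero ((nodup_allMonos s).filter _)
      (fun μ hμ => (pairwise_of_mem_allMonos (List.mem_of_mem_filter hμ)).nodup)
      (fun μ hμ μ' hμ' hs => eq_of_mem_allMonos_of_sameSet (List.mem_of_mem_filter hμ)
        (List.mem_of_mem_filter hμ') hs) fun v => ?_
    have h1 : evalP v L = evalP v (canonP s q₁) + evalP v (canonP s q₂) := by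
      rw [hL, evalP_filter, canonP, evalP_filter, canonP, evalP_filter, ← List.sum_map_add]
      congr 1
      exact List.map_congr_left fun μ _ => ite_xor_eq_add _ _ _
    rw [h1, h v, CharTwo.add_self_eq_zero]
  have hc : ∀ μ ∈ allMonos s, c₁ μ = c₂ μ := by
    intro μ hμ
    have := List.filter_eq_nil_iff.1 hLnil μ hμ
    revert this
    cases c₁ μ <;> cases c₂ μ <;> simp
  exact List.filter_congr hc

/-- The canonical form of a map has the same values, coordinatewise. [folklore] -/
theorem evalM_canonM (v : ℕ → ZMod 2) {s : ℕ} {Q : List (List (List ℕ))}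
    (hQ : ∀ q ∈ Q, ∀ ν ∈ q, (∀ i ∈ ν, i < s) ∧ ν.toFinset.card ≤ 3) :
    evalM v (canonM s Q) = evalM v Q := by
  rw [canonM, evalM, evalM, List.map_map]
  exact List.map_congr_left fun q hq => evalP_canonP v (hQ q hq)

/-- **Canonicity for maps**: canonical forms of maps with the same number of coordinates and the same
values are equal. [folklore] -/
theorem canonM_eq_of_evalM_eq {s : ℕ} {Q₁ Q₂ : List (List (List ℕ))} (hlen : Q₁.length = Q₂.length)
    (h : ∀ v : ℕ → ZMod 2, evalM v (canonM s Q₁) = evalM v (canonM s Q₂)) :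
    canonM s Q₁ = canonM s Q₂ := by
  refine List.ext_getElem (by simpa using hlen) fun i h₁ h₂ => ?_
  simp only [canonM, List.getElem_map]
  refine canonP_eq_of_evalP_eq fun v => ?_
  have := congrArg (fun l : List (ZMod 2) => l[i]?) (h v)
  simp only [evalM, canonM, List.map_map, List.getElem?_map] at this
  rw [List.getElem?_eq_getElem (by simpa using h₁), List.getElem?_eq_getElem (by simpa using h₂)] at this
  simpa using this

end OKit

/-- **Uniqueness of the algebraic normal form (anchor of the helper file)**: canonical forms with the
same values on all `F₂`-valuations are equal. [folklore] -/
theorem orbitKit_anf_unique {s : ℕ} {q₁ q₂ : List (List ℕ)}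
    (h : ∀ v : ℕ → ZMod 2, evalP v (OKit.canonP s q₁) = evalP v (OKit.canonP s q₂)) :
    OKit.canonP s q₁ = OKit.canonP s q₂ :=
  OKit.canonP_eq_of_evalP_eq h

end Summit.PneNP.PneNP.Cruxes.PeaWorstToAvg.OrbitPairRsr
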